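import Mathlib
import HarnessLib
import Summits.HubbardSuperconductivity.HubbardSuperconductivity.Theorems.ChiralWindowCwKLChiralWindowChannelBoundXOps
import Summits.HubbardSuperconductivity.HubbardSuperconductivity.Theorems.ChiralWindowCwKLChiralWindowChannelBound
import Summits.HubbardSuperconductivity.HubbardSuperconductivity.Theorems.ChiralWindowCwKLChiralWindowBottomStates
import Literature.Analysis.OperatorTheory.TempleCertificateResidual
import Literature.Analysis.OperatorTheory.CompactCompression
import Literature.MathematicalPhysics.QuantumLattice.KohnLuttingerChannelStates

/-!
# Crux `CwKLChiralWindow` (stmt-1741), line `Sketch`: certified bounds for the `E` channel bottom from the `E_x` BLOCK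

`E_x`-block variant of `…ChannelBoundR`.  For `μ ∈ (-4,0)`, the plain kernel `χ₀(k+k')`, an `E`-channel trial function `Φ`
that is EVEN under the axis reflection `(k₀,k₁) ↦ (k₀,-k₁)`, and an admissible deflation `Σ c_m u_m ⊗ u_m` whose kernel is
rotation invariant, given enclosures `ρlo N ≤ Q ≤ ρhi N`, `ρhi < 0`, `R_s = ∫ (∫ χ₀ Φ - s Φ)² ≤ et N`,
`H = ∫∫ (K_E - Σ c u⊗u)² ≤ h`, `β ≤ 0`, `h/2 - ρhi² ≤ β²`, `ρhi < β`, the channel bottom obeys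
`min g(ρlo) g(ρhi) ≤ channelInf ε₀ μ 1 E ≤ ρhi`, `g(ρ) = (βρ - ρ² - et)/(β - ρ)` — `stub_klChannelBoundX`.  Compared with
`stub_klChannelBoundR` (`d = 2`, mass `h`) the certificate runs on the reflection-even block `E_x = {P v = v, S v = v}` of the
`E` sector, where the bottom is simple (`d = 1`) and the deflated square mass is `h/2` (halved family bound of `kl_cbx_ops`);
the Rayleigh lower bound transfers from the block to the whole sector by the decomposition `v = ½(v+Sv) + U₃ (U₁ ½(v-Sv))`
(`kl_cbx_rayleigh_sector`), and the translation to `channelInf` / pairing forms is the dictionary `kl_bs_toLp`, `kl_bs_repr`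
of `…BottomStates`.  `kl_cbx_setup` keeps the whole package (operators with the reflection, block, compression, trial vector,
bottom eigenvalue with Temple/Kato/multiplicity data, sector Rayleigh bound) for the `E_x` node-covering file.
-/

noncomputable section

set_option linter.dupNamespace false

namespace Summit.HubbardSuperconductivity.HubbardSuperconductivity.Theorems

open MeasureTheory Literature.MathematicalPhysics.QuantumLattice Literature.Analysis.OperatorTheory

/-! ### The setup: block, compression, trial vector, Temple -/

set_option maxHeartbeats 800000 in
/-- **The certified `E_x`-block package.** Operators `A, P, S, U₁, U₃` of `…ChannelBoundXOps` (`kl_cbx_ops`), the block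
`V = {v | P v = v, S v = v} = ker (1 - P) ⊓ ker (1 - S)` (closed, invariant under `A`), the compression `T` of `A` to `V`,
the normalised trial vector `x = Φ/√N ∈ V` (`Φ` an `E`-channel, reflection-even function), and the bottom eigenvalue `l` of
`T` with the conclusions of `temple_certificate_residual` for multiplicity `d = 1` and negative square mass `h/2` (Ritz
`l ≤ ρhi`, Temple `min g ≤ l` with `g(ρ) = (βρ - ρ² - et)/(β - ρ)`, Rayleigh `≥ l` on the block, gap `β`, Kato enclosure
`‖x - v‖² ≤ et/(β - ρhi)²`, multiplicity mass `m ρhi² ≤ h/2`), AND the Rayleigh bound `l ‖v‖² ≤ ⟪v, Av⟫` on the whole `E`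
sector (block decomposition `kl_cbx_rayleigh_sector`). [folklore] -/
theorem kl_cbx_setup {μ : ℝ} (hμ : μ ∈ Set.Ioo (-4 : ℝ) 0) {M : ℕ} {c : Fin M → ℝ} {u : Fin M → Momentum → ℝ}
    (hu : ∀ m, MemLp (u m) 2 (fermiCurveMeasure (squareDispersion 1 0) μ)) (hc : ∀ m, 0 ≤ c m)
    {Φ : Momentum → ℝ} (hΦ : MemLp Φ 2 (fermiCurveMeasure (squareDispersion 1 0) μ)) (hΦch : InChannel D4Irrep.E Φ)
    (hΦrefl : ∀ k, Φ (reflMomentum k) = Φ k)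
    (hDrot : ∀ k k', ∑ m, c m * (u m (rotMomentum k) * u m (rotMomentum k')) = ∑ m, c m * (u m k * u m k'))
    {ρlo ρhi et h β s : ℝ}
    (hN : 0 < ∫ k, Φ k ^ 2 ∂fermiCurveMeasure (squareDispersion 1 0) μ)
    (hρlo : ρlo * ∫ k, Φ k ^ 2 ∂fermiCurveMeasure (squareDispersion 1 0) μ ≤
      ∫ k, Φ k * ∫ k', lindhardFunction (squareDispersion 1 0) μ (k + k') * Φ k'
        ∂fermiCurveMeasure (squareDispersion 1 0) μ ∂fermiCurveMeasure (squareDispersion 1 0) μ)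
    (hρhi : ∫ k, Φ k * ∫ k', lindhardFunction (squareDispersion 1 0) μ (k + k') * Φ k'
        ∂fermiCurveMeasure (squareDispersion 1 0) μ ∂fermiCurveMeasure (squareDispersion 1 0) μ ≤
      ρhi * ∫ k, Φ k ^ 2 ∂fermiCurveMeasure (squareDispersion 1 0) μ)
    (hρhi0 : ρhi < 0)
    (hres : ∫ k, (∫ k', lindhardFunction (squareDispersion 1 0) μ (k + k') * Φ k'
        ∂fermiCurveMeasure (squareDispersion 1 0) μ - s * Φ k) ^ 2 ∂fermiCurveMeasure (squareDispersion 1 0) μ ≤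
      et * ∫ k, Φ k ^ 2 ∂fermiCurveMeasure (squareDispersion 1 0) μ)
    (hH : ∫ z, (d4Project D4Irrep.E (fun q => lindhardFunction (squareDispersion 1 0) μ (z.1 + q)) z.2 -
        ∑ m, c m * (u m z.1 * u m z.2)) ^ 2
        ∂(fermiCurveMeasure (squareDispersion 1 0) μ).prod (fermiCurveMeasure (squareDispersion 1 0) μ) ≤ h)
    (hβ0 : β ≤ 0) (hβ : h / 2 - ρhi ^ 2 ≤ β ^ 2) (hρβ : ρhi < β) :
    ∃ (A P S U₁ U₃ : Lp ℝ 2 (fermiCurveMeasure (squareDispersion 1 0) μ) →L[ℝ] Lp ℝ 2 (fermiCurveMeasure (squareDispersion 1 0) μ))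
      (V : Submodule ℝ (Lp ℝ 2 (fermiCurveMeasure (squareDispersion 1 0) μ))) (T : V →L[ℝ] V) (x : V) (l : ℝ),
      -- the block
      (∀ v, v ∈ V ↔ (P v = v ∧ S v = v)) ∧ CompleteSpace V ∧
      -- the kernel operator and the projection
      (∀ φ : Lp ℝ 2 (fermiCurveMeasure (squareDispersion 1 0) μ),
        (A φ : Momentum → ℝ) =ᵐ[fermiCurveMeasure (squareDispersion 1 0) μ]
          fun k => ∫ k', lindhardFunction (squareDispersion 1 0) μ (k + k') * φ k'
            ∂fermiCurveMeasure (squareDispersion 1 0) μ) ∧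
      (∀ φ ψ : Lp ℝ 2 (fermiCurveMeasure (squareDispersion 1 0) μ),
        inner ℝ ψ (A φ) = ∫ k, ψ k * ∫ k', lindhardFunction (squareDispersion 1 0) μ (k + k') * φ k'
          ∂fermiCurveMeasure (squareDispersion 1 0) μ ∂fermiCurveMeasure (squareDispersion 1 0) μ) ∧
      IsSelfAdjoint A ∧ IsCompactOperator A ∧ A * P = P * A ∧
      P * P = P ∧ IsSelfAdjoint P ∧ P = (1 / 2 : ℝ) • (1 - U₁ * U₁) ∧
      (∀ φ : Lp ℝ 2 (fermiCurveMeasure (squareDispersion 1 0) μ),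
        (P φ : Momentum → ℝ) =ᵐ[fermiCurveMeasure (squareDispersion 1 0) μ] fun k => d4Project D4Irrep.E φ k) ∧
      (∀ (ψ : Momentum → ℝ) (hψ : MemLp ψ 2 (fermiCurveMeasure (squareDispersion 1 0) μ)),
        InChannel D4Irrep.E ψ → P (hψ.toLp ψ) = hψ.toLp ψ) ∧
      (∀ φ : Lp ℝ 2 (fermiCurveMeasure (squareDispersion 1 0) μ), P φ = φ →
        ∃ ψ : Momentum → ℝ, InChannel D4Irrep.E ψ ∧ MemLp ψ 2 (fermiCurveMeasure (squareDispersion 1 0) μ) ∧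
          (φ : Momentum → ℝ) =ᵐ[fermiCurveMeasure (squareDispersion 1 0) μ] ψ) ∧
      -- the quarter turn and its cube
      (∀ φ : Lp ℝ 2 (fermiCurveMeasure (squareDispersion 1 0) μ),
        (U₁ φ : Momentum → ℝ) =ᵐ[fermiCurveMeasure (squareDispersion 1 0) μ] fun k => φ (rotMomentum k)) ∧
      A * U₁ = U₁ * A ∧ P * U₁ = U₁ * P ∧
      (∀ φ ψ : Lp ℝ 2 (fermiCurveMeasure (squareDispersion 1 0) μ), inner ℝ (U₁ φ) (U₁ ψ) = inner ℝ φ ψ) ∧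
      (∀ φ ψ : Lp ℝ 2 (fermiCurveMeasure (squareDispersion 1 0) μ), inner ℝ (U₁ φ) ψ = inner ℝ φ (U₃ ψ)) ∧
      U₃ = U₁ * U₁ * U₁ ∧ U₁ * U₃ = 1 ∧ U₃ * U₁ = 1 ∧
      (∀ v : Lp ℝ 2 (fermiCurveMeasure (squareDispersion 1 0) μ), P v = v → inner ℝ v (U₁ v) = 0) ∧
      (∀ v : Lp ℝ 2 (fermiCurveMeasure (squareDispersion 1 0) μ), P v = v → U₁ (U₁ v) = -v) ∧
      (∀ v : Lp ℝ 2 (fermiCurveMeasure (squareDispersion 1 0) μ), P v = v → U₃ v = -U₁ v) ∧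
      -- the reflection
      (∀ φ : Lp ℝ 2 (fermiCurveMeasure (squareDispersion 1 0) μ),
        (S φ : Momentum → ℝ) =ᵐ[fermiCurveMeasure (squareDispersion 1 0) μ] fun k => φ (reflMomentum k)) ∧
      S * S = 1 ∧ A * S = S * A ∧ S * P = P * S ∧
      (∀ φ ψ : Lp ℝ 2 (fermiCurveMeasure (squareDispersion 1 0) μ), inner ℝ (S φ) ψ = inner ℝ φ (S ψ)) ∧
      S * U₁ = U₃ * S ∧
      -- the compression and the trial vector
      (∀ v, (T v : Lp ℝ 2 (fermiCurveMeasure (squareDispersion 1 0) μ)) = A v) ∧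
      ‖x‖ = 1 ∧
      (x : Lp ℝ 2 (fermiCurveMeasure (squareDispersion 1 0) μ)) =
        (Real.sqrt (∫ k, Φ k ^ 2 ∂fermiCurveMeasure (squareDispersion 1 0) μ))⁻¹ • hΦ.toLp Φ ∧
      -- the bottom eigenvalue of the block and the Temple / Kato / multiplicity conclusions (`d = 1`, mass `h/2`)
      (∃ v, v ≠ 0 ∧ T v = l • v) ∧ l ≤ ρhi ∧
      min ((β * ρlo - ρlo ^ 2 - et) / (β - ρlo)) ((β * ρhi - ρhi ^ 2 - et) / (β - ρhi)) ≤ l ∧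
      (∀ y, l * ‖y‖ ^ 2 ≤ inner ℝ y (T y)) ∧
      (∀ (c' : ℝ) (v), v ≠ 0 → T v = c' • v → c' = l ∨ β ≤ c') ∧
      (∃ v, T v = l • v ∧ ‖x - v‖ ^ 2 ≤ et / (β - ρhi) ^ 2) ∧
      (∀ (m : ℕ) (w : Fin m → V), Orthonormal ℝ w → (∀ j, T (w j) = l • w j) → (m : ℝ) * ρhi ^ 2 ≤ h / 2) ∧
      -- the Rayleigh bound on the whole `E` sector
      (∀ v : Lp ℝ 2 (fermiCurveMeasure (squareDispersion 1 0) μ), P v = v → l * ‖v‖ ^ 2 ≤ inner ℝ v (A v)) := by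
  haveI : IsFiniteMeasure (fermiCurveMeasure (squareDispersion 1 0) μ) :=
    stub_klFiniteMeasure stub_klGradient stub_klHausdorffFinite μ hμ
  obtain ⟨A, P, S, U₁, U₃, hA, hAinner, hAsa, hAc, hAP, hPP, hPsa, hPdef, hPae, hPfix, hPrepr, hU₁ae, hAU, hPU, hUinner, hadj, hU₃, h13, h31,
    hskew, hrot2, hneg, hSae, hSS, hAS, hSP, hSsym, hSU, hHS, hBpos⟩ := kl_cbx_ops μ hμ M c u hu hc hDrot
  -- the block and the compression
  obtain ⟨V, hmemV, hVc⟩ : ∃ V : Submodule ℝ (Lp ℝ 2 (fermiCurveMeasure (squareDispersion 1 0) μ)),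
      (∀ v, v ∈ V ↔ (P v = v ∧ S v = v)) ∧ CompleteSpace V := by
    refine ⟨((1 : _ →L[ℝ] _) - P).ker ⊓ ((1 : _ →L[ℝ] _) - S).ker,
      fun v => Submodule.mem_inf.trans (and_congr (kl_cb_mem_ker_iff P v) (kl_cb_mem_ker_iff S v)), ?_⟩
    have hcl : IsClosed ((((1 : _ →L[ℝ] _) - P).ker ⊓ ((1 : _ →L[ℝ] _) - S).ker :
        Submodule ℝ (Lp ℝ 2 (fermiCurveMeasure (squareDispersion 1 0) μ))) :
        Set (Lp ℝ 2 (fermiCurveMeasure (squareDispersion 1 0) μ))) := by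
      rw [Submodule.coe_inf]
      exact (ContinuousLinearMap.isClosed_ker _).inter (ContinuousLinearMap.isClosed_ker _)
    exact hcl.completeSpace_coe
  haveI : CompleteSpace V := hVc
  have hVA : ∀ v ∈ V, A v ∈ V := by
    intro v hv
    rw [hmemV] at hv ⊢
    constructor
    · rw [← mul_apply_eq_comp, ← hAP, mul_apply_eq_comp, hv.1]
    · rw [← mul_apply_eq_comp, ← hAS, mul_apply_eq_comp, hv.2]
  obtain ⟨T, hT, hTsa', hTc'⟩ := exists_compression A V hVA
  have hTsa := hTsa' hAsa
  have hTc := hTc' hAc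
  -- the trial vector
  have hx₀ae : (hΦ.toLp Φ : Momentum → ℝ) =ᵐ[fermiCurveMeasure (squareDispersion 1 0) μ] Φ := hΦ.coeFn_toLp
  have hx₀V : hΦ.toLp Φ ∈ V := (hmemV _).2 ⟨hPfix Φ hΦ hΦch, kl_cbx_refl_toLp hμ S hSae hΦ hΦrefl⟩
  have hx₀norm : ‖hΦ.toLp Φ‖ ^ 2 = ∫ k, Φ k ^ 2 ∂fermiCurveMeasure (squareDispersion 1 0) μ :=
    kl_bs_norm_sq_eq_integral_of_ae_eq hx₀ae
  have hsqrtN : 0 < Real.sqrt (∫ k, Φ k ^ 2 ∂fermiCurveMeasure (squareDispersion 1 0) μ) := Real.sqrt_pos.2 hN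
  have hxHnorm : ‖(Real.sqrt (∫ k, Φ k ^ 2 ∂fermiCurveMeasure (squareDispersion 1 0) μ))⁻¹ • hΦ.toLp Φ‖ = 1 := by
    rw [norm_smul, Real.norm_eq_abs, abs_of_pos (inv_pos.2 hsqrtN)]
    have : ‖hΦ.toLp Φ‖ = Real.sqrt (∫ k, Φ k ^ 2 ∂fermiCurveMeasure (squareDispersion 1 0) μ) := by
      rw [← Real.sqrt_sq (norm_nonneg (hΦ.toLp Φ)), hx₀norm]
    rw [this, inv_mul_cancel₀ hsqrtN.ne']
  obtain ⟨x, hxnorm, hxdef⟩ : ∃ x : V, ‖x‖ = 1 ∧ (x : Lp ℝ 2 (fermiCurveMeasure (squareDispersion 1 0) μ)) =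
      (Real.sqrt (∫ k, Φ k ^ 2 ∂fermiCurveMeasure (squareDispersion 1 0) μ))⁻¹ • hΦ.toLp Φ :=
    ⟨⟨_, V.smul_mem _ hx₀V⟩, hxHnorm, rfl⟩
  -- Rayleigh quotient and residual of the trial vector
  have hinner₀ : inner ℝ (hΦ.toLp Φ) (A (hΦ.toLp Φ)) = ∫ k, Φ k * ∫ k',
      lindhardFunction (squareDispersion 1 0) μ (k + k') * Φ k'
        ∂fermiCurveMeasure (squareDispersion 1 0) μ ∂fermiCurveMeasure (squareDispersion 1 0) μ :=
    kl_bs_inner_eq_of_ae_eq (fun q => lindhardFunction (squareDispersion 1 0) μ q) A hAinner hx₀ae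
  have hρ : inner ℝ x (T x) = (∫ k, Φ k ^ 2 ∂fermiCurveMeasure (squareDispersion 1 0) μ)⁻¹ *
      inner ℝ (hΦ.toLp Φ) (A (hΦ.toLp Φ)) := by
    rw [(compression_inner_norm hT x).1, hxdef, map_smul, real_inner_smul_left, real_inner_smul_right, ← mul_assoc,
      ← mul_inv, Real.mul_self_sqrt hN.le]
  have hρlo' : ρlo ≤ inner ℝ x (T x) := by
    rw [hρ, hinner₀, le_inv_mul_iff₀ hN]; linarith
  have hρhi' : inner ℝ x (T x) ≤ ρhi := by
    rw [hρ, hinner₀, inv_mul_le_iff₀ hN]; linarith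
  have hAx₀ae : (A (hΦ.toLp Φ) : Momentum → ℝ) =ᵐ[fermiCurveMeasure (squareDispersion 1 0) μ] fun k =>
      ∫ k', lindhardFunction (squareDispersion 1 0) μ (k + k') * Φ k' ∂fermiCurveMeasure (squareDispersion 1 0) μ := by
    filter_upwards [hA (hΦ.toLp Φ)] with k hk
    rw [hk]
    exact kl_bs_kernelIntegral_congr (fun q => lindhardFunction (squareDispersion 1 0) μ q) hx₀ae k
  have hRae : ((A (hΦ.toLp Φ) - s • hΦ.toLp Φ : Lp ℝ 2 (fermiCurveMeasure (squareDispersion 1 0) μ)) : Momentum → ℝ)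
      =ᵐ[fermiCurveMeasure (squareDispersion 1 0) μ] fun k =>
        ∫ k', lindhardFunction (squareDispersion 1 0) μ (k + k') * Φ k'
          ∂fermiCurveMeasure (squareDispersion 1 0) μ - s * Φ k := by
    filter_upwards [Lp.coeFn_sub (A (hΦ.toLp Φ)) (s • hΦ.toLp Φ), Lp.coeFn_smul s (hΦ.toLp Φ), hAx₀ae, hx₀ae]
      with k hk1 hk2 hk3 hk4
    rw [hk1, Pi.sub_apply, hk2, Pi.smul_apply, hk3, hk4, smul_eq_mul]
  have hresx : ‖T x - (s : ℝ) • x‖ ^ 2 ≤ et := by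
    have h1 : ((T x - s • x : V) : Lp ℝ 2 (fermiCurveMeasure (squareDispersion 1 0) μ)) =
        (Real.sqrt (∫ k, Φ k ^ 2 ∂fermiCurveMeasure (squareDispersion 1 0) μ))⁻¹ • (A (hΦ.toLp Φ) - s • hΦ.toLp Φ) := by
      rw [Submodule.coe_sub, Submodule.coe_smul, hT, hxdef, map_smul, smul_sub, smul_comm s]
    rw [← Submodule.norm_coe, h1, norm_smul, mul_pow, Real.norm_eq_abs, abs_of_pos (inv_pos.2 hsqrtN), inv_pow,
      Real.sq_sqrt hN.le, kl_bs_norm_sq_eq_integral_of_ae_eq hRae, inv_mul_le_iff₀ hN]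
    linarith
  -- simple multiplicity on the block
  have hmult : ∀ (c' : ℝ) (v : V), c' < 0 → v ≠ 0 → T v = (c' : ℝ) • v →
      ∃ w : Fin 1 → V, Orthonormal ℝ w ∧ ∀ j, T (w j) = (c' : ℝ) • w j := by
    intro c' v _ hv hTv
    have hvn : ‖(v : Lp ℝ 2 (fermiCurveMeasure (squareDispersion 1 0) μ))‖ ≠ 0 := by
      rw [Submodule.norm_coe]; exact norm_ne_zero_iff.2 hv
    refine ⟨![(‖(v : Lp ℝ 2 (fermiCurveMeasure (squareDispersion 1 0) μ))‖⁻¹ : ℝ) • v], ?_, ?_⟩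
    · rw [orthonormal_iff_ite]
      intro i j
      fin_cases i; fin_cases j
      simp only [Fin.zero_eta, Fin.isValue, Matrix.cons_val_fin_one, ↓reduceIte]
      rw [Submodule.coe_inner, Submodule.coe_smul, real_inner_smul_left, real_inner_smul_right,
        real_inner_self_eq_norm_sq]
      field_simp
    · intro j
      fin_cases j
      simp only [Fin.zero_eta, Fin.isValue, Matrix.cons_val_fin_one, map_smul, hTv]
      rw [smul_comm]
  -- negative square mass `≤ h/2` on the block
  have hfam : ∀ (m : ℕ) (f : Fin m → Lp ℝ 2 (fermiCurveMeasure (squareDispersion 1 0) μ)), Orthonormal ℝ f →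
      (∀ j, f j ∈ V) →
      ∑ j, ‖A (f j) - (∑ m, c m • (innerSL ℝ ((hu m).toLp (u m))).smulRight ((hu m).toLp (u m))) (f j)‖ ^ 2 ≤ h / 2 :=
    fun m f hf hfV => (hHS m f hf (fun j => ((hmemV _).1 (hfV j)).1) fun j => ((hmemV _).1 (hfV j)).2).trans
      (by linarith)
  have hsq := negSqMass_le_of_family_bound (𝕜 := ℝ) hT (fun y => by simpa using hBpos y) hfam
  -- Temple
  have hβ' : h / 2 - (1 : ℕ) * ρhi ^ 2 ≤ β ^ 2 := by simpa using hβ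
  obtain ⟨l, hl, hlρ, hLl, hray, hgap, hkato, hmass⟩ :=
    temple_certificate_residual (𝕜 := ℝ) hTc hTsa (d := 1) le_rfl hmult hsq hxnorm (by simpa using hρlo')
      (by simpa using hρhi') hρhi0 hresx hβ0 hβ' hρβ
  have hray' : ∀ y : V, l * ‖y‖ ^ 2 ≤ inner ℝ y (T y) := fun y => by simpa using hray y
  -- Rayleigh on the whole `E` sector
  have hrayV : ∀ v : Lp ℝ 2 (fermiCurveMeasure (squareDispersion 1 0) μ), P v = v → S v = v →
      l * ‖v‖ ^ 2 ≤ inner ℝ v (A v) := by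
    intro v hPv hSv
    have h1 := hray' ⟨v, (hmemV _).2 ⟨hPv, hSv⟩⟩
    rw [(compression_inner_norm hT _).1] at h1
    exact h1
  have hsector : ∀ v : Lp ℝ 2 (fermiCurveMeasure (squareDispersion 1 0) μ), P v = v → l * ‖v‖ ^ 2 ≤ inner ℝ v (A v) :=
    fun v hv => kl_cbx_rayleigh_sector hAS hAU hSP hPU hSS hSsym hSU hUinner hneg hrayV hv
  refine ⟨A, P, S, U₁, U₃, V, T, x, l, hmemV, hVc, hA, hAinner, hAsa, hAc, hAP, hPP, hPsa, hPdef, hPae, hPfix, hPrepr, hU₁ae, hAU, hPU, hUinner,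
    hadj, hU₃, h13, h31, hskew, hrot2, hneg, hSae, hSS, hAS, hSP, hSsym, hSU, hT, hxnorm, hxdef, ?_, hlρ, hLl, hray',
    ?_, ?_, hmass, hsector⟩
  · obtain ⟨v, hv, hTv⟩ := hl
    exact ⟨v, hv, by simpa using hTv⟩
  · intro c' v hv hTv
    exact hgap c' v hv (by simpa using hTv)
  · obtain ⟨v, hTv, hdist⟩ := hkato
    exact ⟨v, by simpa using hTv, hdist⟩

/-! ### The stub: bounds for the `E` channel bottom -/

set_option maxHeartbeats 400000 in
/-- **Certified bounds for the `E` channel bottom from the `E_x` block** (`stub_klChannelBoundX`): for `μ ∈ (-4,0)`, an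
`E`-channel reflection-even trial `Φ`, an admissible deflation with rotation-invariant kernel and enclosures
`ρlo N ≤ Q ≤ ρhi N`, `ρhi < 0`, `R_s ≤ et N`, `H ≤ h`, `β ≤ 0`, `h/2 - ρhi² ≤ β²`, `ρhi < β` (plain kernel `χ₀(k+k')`):
`min g(ρlo) g(ρhi) ≤ channelInf ε₀ μ 1 E ≤ ρhi` (Temple on the `E_x` block via `kl_cbx_setup`, transferred to the whole
sector; Ritz with the trial; pairing forms of `E` channel states are the Rayleigh quotients of `A` on `P`-fixed unit vectors,
`kl_bs_toLp`, `kl_bs_repr`). [cite: ReedSimonIV1978, Thm. XIII.5] -/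
theorem stub_klChannelBoundX : ∀ μ ∈ Set.Ioo (-4 : ℝ) 0, ∀ (M : ℕ) (c : Fin M → ℝ) (u : Fin M → Momentum → ℝ)
    (Φ : Momentum → ℝ) (ρlo ρhi et h β s : ℝ),
    (∀ m, 0 ≤ c m) → (∀ m, MemLp (u m) 2 (fermiCurveMeasure (squareDispersion 1 0) μ)) →
    MemLp Φ 2 (fermiCurveMeasure (squareDispersion 1 0) μ) → InChannel D4Irrep.E Φ →
    (∀ k, Φ (reflMomentum k) = Φ k) →
    (∀ k k', ∑ m, c m * (u m (rotMomentum k) * u m (rotMomentum k')) = ∑ m, c m * (u m k * u m k')) →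
    0 < ∫ k, Φ k ^ 2 ∂fermiCurveMeasure (squareDispersion 1 0) μ →
    ρlo * ∫ k, Φ k ^ 2 ∂fermiCurveMeasure (squareDispersion 1 0) μ ≤
      ∫ k, Φ k * ∫ k', lindhardFunction (squareDispersion 1 0) μ (k + k') * Φ k'
        ∂fermiCurveMeasure (squareDispersion 1 0) μ ∂fermiCurveMeasure (squareDispersion 1 0) μ →
    ∫ k, Φ k * ∫ k', lindhardFunction (squareDispersion 1 0) μ (k + k') * Φ k'
        ∂fermiCurveMeasure (squareDispersion 1 0) μ ∂fermiCurveMeasure (squareDispersion 1 0) μ ≤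
      ρhi * ∫ k, Φ k ^ 2 ∂fermiCurveMeasure (squareDispersion 1 0) μ →
    ρhi < 0 →
    ∫ k, (∫ k', lindhardFunction (squareDispersion 1 0) μ (k + k') * Φ k'
        ∂fermiCurveMeasure (squareDispersion 1 0) μ - s * Φ k) ^ 2 ∂fermiCurveMeasure (squareDispersion 1 0) μ ≤
      et * ∫ k, Φ k ^ 2 ∂fermiCurveMeasure (squareDispersion 1 0) μ →
    ∫ z, (d4Project D4Irrep.E (fun q => lindhardFunction (squareDispersion 1 0) μ (z.1 + q)) z.2 -
        ∑ m, c m * (u m z.1 * u m z.2)) ^ 2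
        ∂(fermiCurveMeasure (squareDispersion 1 0) μ).prod (fermiCurveMeasure (squareDispersion 1 0) μ) ≤ h →
    β ≤ 0 → h / 2 - ρhi ^ 2 ≤ β ^ 2 → ρhi < β →
    min ((β * ρlo - ρlo ^ 2 - et) / (β - ρlo)) ((β * ρhi - ρhi ^ 2 - et) / (β - ρhi)) ≤
      channelInf (squareDispersion 1 0) μ 1 D4Irrep.E ∧
    channelInf (squareDispersion 1 0) μ 1 D4Irrep.E ≤ ρhi
 := by
  intro μ hμ M c u Φ ρlo ρhi et h β s hc hu hΦ hΦch hΦrefl hDrot hN hρlo hρhi hρhi0 hres hH hβ0 hβ hρβ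
  obtain ⟨A, P, S, U₁, U₃, V, T, x, l, hmemV, -, -, hAinner, -, -, -, -, -, -, -, hPfix, hPrepr, -, -, -, -, -, -, -, -, -, -, -, -, -,
    -, -, -, -, hT, hxnorm, hxdef, -, -, hLl, -, -, -, -, hsector⟩ :=
    kl_cbx_setup hμ hu hc hΦ hΦch hΦrefl hDrot hN hρlo hρhi hρhi0 hres hH hβ0 hβ hρβ
  have hE : D4Irrep.E ≠ D4Irrep.A1g := by decide
  -- every `E` channel state has pairing form `≥ l`
  have hlow : ∀ ψ, IsChannelState (squareDispersion 1 0) μ D4Irrep.E ψ →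
      l ≤ pairingForm (squareDispersion 1 0) μ 1 ψ := by
    intro ψ hψ
    obtain ⟨hfix, hnorm, hval⟩ := kl_bs_toLp hμ hE hAinner hPfix hψ
    have h1 := hsector _ hfix
    rw [hnorm, one_pow, mul_one, hval] at h1
    exact h1
  have hne : ((pairingForm (squareDispersion 1 0) μ 1) '' {ψ | IsChannelState (squareDispersion 1 0) μ D4Irrep.E ψ}).Nonempty :=
    (nonempty_isChannelState hμ.1 hμ.2 D4Irrep.E).image _
  have hbdd : BddBelow ((pairingForm (squareDispersion 1 0) μ 1) '' {ψ | IsChannelState (squareDispersion 1 0) μ D4Irrep.E ψ}) :=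
    ⟨l, by rintro r ⟨ψ, hψ, rfl⟩; exact hlow ψ hψ⟩
  refine ⟨hLl.trans (le_csInf hne (by rintro r ⟨ψ, hψ, rfl⟩; exact hlow ψ hψ)), ?_⟩
  -- the upper bound from the representative of the trial vector
  have hxfix : P (x : Lp ℝ 2 (fermiCurveMeasure (squareDispersion 1 0) μ)) = x := ((hmemV _).1 x.2).1
  have hnorm1 : ‖(x : Lp ℝ 2 (fermiCurveMeasure (squareDispersion 1 0) μ))‖ = 1 := hxnorm
  obtain ⟨ψ, hstate, -, hval⟩ := kl_bs_repr hμ hE hAinner hPrepr hxfix hnorm1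
  have hρx : inner ℝ (x : Lp ℝ 2 (fermiCurveMeasure (squareDispersion 1 0) μ)) (A x) ≤ ρhi := by
    have hinner₀ := kl_bs_inner_eq_of_ae_eq _ A hAinner hΦ.coeFn_toLp
    have hsqrtN : 0 < Real.sqrt (∫ k, Φ k ^ 2 ∂fermiCurveMeasure (squareDispersion 1 0) μ) := Real.sqrt_pos.2 hN
    rw [hxdef, map_smul, real_inner_smul_left, real_inner_smul_right, ← mul_assoc, ← mul_inv, Real.mul_self_sqrt hN.le,
      hinner₀, inv_mul_le_iff₀ hN]
    linarith
  calc channelInf (squareDispersion 1 0) μ 1 D4Irrep.E ≤ pairingForm (squareDispersion 1 0) μ 1 ψ :=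
        csInf_le hbdd ⟨ψ, hstate, rfl⟩
    _ ≤ ρhi := hval ▸ hρx

end Summit.HubbardSuperconductivity.HubbardSuperconductivity.Theorems

end
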